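import Summits.BirchSwinnertonDyer.Rank1Residual.GaloisImage.PrimeChoiceSakamotoTorsion
import Summits.BirchSwinnertonDyer.Rank1Residual.GaloisImage.KolyvaginSystemsKummerVanishRatCanonical
import HarnessLib

/-!
# `KS₁(E[p], 𝓚, 𝒫(τ)) = 0` over `ℚ` for the canonical datum, `ρ̄_{E,p}` onto: BOTH Kolyvagin-prime
# binders (`hadm` AND `hC55`) discharged
# (cell `b2b-bsdres`, team n1011, rows T-C55K × T-HCC-adm × R1-16; seat p15 gen 2; file 7)

HONEST FRAMING (cell `b2b-bsdres`, run/shared/lean/b2b/bsd-rank1-residual/, verbatim in every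
file): the goal of the cell is to DELETE the COMBINATION-SHAPED residual classes of the
Birch–Swinnerton-Dyer formula for ALL analytic-rank `≤ 1` elliptic curves over `ℚ` — "full BSD
formula for every rank `≤ 1` curve in class `C`" assembled STRICTLY from published theorems — so
that the rank-`≤ 1` remainder becomes exactly the CONSTRUCTION-SHAPED classes, which are TYPED
(missing-input `Prop`s), NOT attempted. This is not "finishing BSD". Team n1011 (N10/N11, the
additive block `X4 ∧ p = 3`): research route; TOOL theorem about Kolyvagin systems of `E[p]`, NOT a
class theorem, nothing booked, no mark changed; no definition, no named fact.

## What

n1011-p11's R1-16 FILE 6′ `CoreRankZero.kummer_kolyvaginSystems_eq_bot_rat_of_hasCanonicalComparison`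
(Rubin PCMI Thm. 2.7.6 / [MR04] Thm. 4.2.2 at `m = 1` for the classical Kummer structure `𝓚` over
`ℚ`, with the admissibility binder discharged by T-HCC-adm, [MR04] Lemma 1.2.3) keeps ONE
Kolyvagin-prime binder: `hC55` ([S24] Cor. 5.5).  Row T-C55K proved `hC55` from `ρ̄_{E,p}` onto
(`PrimeChoice.hC55_of_hasSurjectiveModNGaloisRep`).  This file is the composition:

* `kummer_kolyvaginSystems_eq_bot_rat_canonical_of_hasSurjectiveModNGaloisRep` — for `E/ℚ`, an odd
  prime `p` with `ρ̄_{E,p}` SURJECTIVE, and a CANONICAL Kolyvagin datum `D` on `E[p]` relative to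
  `τ` (`D.primes = 𝒫(τ)`, cyclotomic transverse conditions, `D.HasCanonicalComparison p η`):
  **`KS₁(E[p], 𝓚, 𝒫(τ)) = ⊥`**, the remaining hypotheses being ONLY the Poitou–Tate family
  (`hperf`, `hsum`, `hcompl`), Tate's local Euler characteristic `hEP`, and the finite set `S`
  (`hS`, `h𝓚`) — no Chebotarev binder, no admissibility binder.  This is the annex-X1 clause
  "`KS(E[3], 𝓕_cl, 𝒫) = 0`" of ROUTE-1 §16.4/§18.6 in the kernel on every N11 row (surj(3)),
  modulo the Poitou–Tate / Euler-characteristic facts alone.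

A partial application of p11's theorem to row T-C55K's discharge; p11's file is untouched.

References: K. Rubin, PCMI 18 (2011), Thm. 2.7.6; B. Mazur, K. Rubin, Mem. AMS 799 (2004),
Thm. 4.2.2, Lemma 1.2.3, Prop. 3.6.1; R. Sakamoto, JTNB 36 (2024), Cor. 5.5.
-/

noncomputable section

open scoped Classical NumberField ContRepresentation
open Function Field NumberField IsDedekindDomain WeierstrassCurve
open Literature.NumberTheory.EllipticCurves
open Literature.NumberTheory.GaloisRepresentations Literature.NumberTheory.GaloisRepresentations.DiscreteGaloisModule
  Literature.NumberTheory.GaloisCohomology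

namespace Summit.BirchSwinnertonDyer.Rank1Residual.GaloisImage.PrimeChoice

/-- **`KS₁(E[p], 𝓚, 𝒫(τ)) = 0` over `ℚ` for the CANONICAL datum under `ρ̄_{E,p}` onto, `p` odd —
NO Kolyvagin-prime binder left.**  n1011-p11's
`CoreRankZero.kummer_kolyvaginSystems_eq_bot_rat_of_hasCanonicalComparison` (R1-16 FILE 6′: Rubin
PCMI Thm. 2.7.6 at `m = 1`, `χ(𝓚) = 0`, admissibility from [MR04] Lemma 1.2.3 = T-HCC-adm) with its
last prime binder `hC55` ([S24] Cor. 5.5) SUPPLIED by `hC55_of_hasSurjectiveModNGaloisRep`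
(row T-C55K: Mazur–Rubin Prop. 3.6.1 / Sakamoto Lemma 5.2 from the tree's proved Chebotarev, with
(H.1) and (H.3) from surjectivity).  Remaining hypotheses: the Poitou–Tate family, `hEP`, `hS`,
`h𝓚`, the datum's shape (`hP`, `hT`, `hτ`, `hτμ`, `hD`) and `ρ̄_{E,p}` onto.
[cite: Rubin2011, Thm. 2.7.6 (p. 24)] [cite: MazurRubin2004, Thm. 4.2.2, Lemma 1.2.3 and Prop. 3.6.1]
[cite: Sakamoto2024, Cor. 5.5 (p. 929)] -/
theorem kummer_kolyvaginSystems_eq_bot_rat_canonical_of_hasSurjectiveModNGaloisRep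
    (W : WeierstrassCurve ℚ) [W.IsElliptic] (p : ℕ) [Fact p.Prime] (hp2 : p ≠ 2)
    [Module (ZMod p) (geomTorsion W (p : ℤ))] [Module.Free (ZMod p) (geomTorsion W (p : ℤ))]
    [Module.Finite (ZMod p) (geomTorsion W (p : ℤ))]
    (hsurj : W.HasSurjectiveModNGaloisRep (p : ℤ))
    {inv : LocalInvariants ℚ p}
    (hperf : inv.IsPerfect) (hsum : inv.SumLocalTermEqZero) (hcompl : inv.SelmerComplement)
    (hEP : ∀ v : HeightOneSpectrum (𝓞 ℚ), localEulerPoincareCharacteristic (v.adicCompletion ℚ))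
    {S : Finset (Place ℚ)}
    (hS : ∀ v : HeightOneSpectrum (𝓞 ℚ), (Sum.inr v : Place ℚ) ∉ S →
      ((p : ℕ) : 𝓞 ℚ) ∉ v.asIdeal ∧ GaloisRep.IsUnramifiedAt v (W.torsionGaloisModule (p : ℤ)))
    (h𝓚 : (W.kummerSelmerStructure (p : ℤ)).IsUnramifiedOutside S)
    {D : KolyvaginDatum (W.torsionGaloisModule (p : ℤ))} {τ : absoluteGaloisGroup ℚ}
    (hP : D.primes = frobeniusClassPrimes (W.torsionGaloisModule (p : ℤ))
      {v | (Sum.inr v : Place ℚ) ∈ S} τ p)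
    (hT : D.transverse = cyclotomicTransverse (W.torsionGaloisModule (p : ℤ)))
    (hτ : Nonempty (cokerSubOne (W.torsionGaloisModule (p : ℤ)) τ ≃+ ZMod p))
    (hτμ : τ ∈ rootsOfUnityFixer ℚ p)
    {η : (q : HeightOneSpectrum (𝓞 ℚ)) → (ZMod (Ideal.absNorm q.asIdeal))ˣ}
    (hD : D.HasCanonicalComparison p η) :
    D.kolyvaginSystems (W.kummerSelmerStructure (p : ℤ)) = ⊥ :=
  CoreRankZero.kummer_kolyvaginSystems_eq_bot_rat_of_hasCanonicalComparison W p hp2 hperf hsum hcompl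
    hEP hS h𝓚 hP hT hτ hτμ hD (hC55_of_hasSurjectiveModNGaloisRep W p hp2 hsurj hP hτ)

end Summit.BirchSwinnertonDyer.Rank1Residual.GaloisImage.PrimeChoice

end
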